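import Literature.AlgebraicGeometry.Morphisms.FormalModuleIsogenyRoof

/-!
# The roof of the push–pull comparison with an ISOGENY as first leg (Stacks 088B)

`Literature/AlgebraicGeometry/Morphisms/FormalModuleIsogenyRoof.lean` turns a roof
`𝓕 —u→ P ←v— H^` with `u` a MONOMORPHISM with torsion cokernel and `v` an isogeny (torsion kernel and
cokernel) into a morphism `α : 𝓕 → H^` with torsion kernel and cokernel (The Stacks Project, Tag 088B;
Görtz–Wedhorn II, Construction 24.104 (3), Lemma 24.105). In the application to a Chow cover
`ρ : X' → X` of a normal scheme the first leg is the unit `𝓕_n → ρ_*ρ^*𝓕_n`, whose kernel is in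
general only killed by a power of `a` (the Artin–Rees half of the theorem on formal functions for
`𝒪_{X'}`), not zero. This file records the variant with `u` an ISOGENY as well:

* `exists_hom_of_roof_of_torsion` — abelian category, central `ε`, `ε'`, `ε''`: `u` with kernel killed
  by `ε''` and cokernel killed by `ε'`, `v` with kernel and cokernel killed by `ε` ⇒ `α = u ≫ w` has
  kernel killed by `ε²ε''` and cokernel killed by `ε'ε²`;
* `exists_towerHom_of_powTorsion_roof_of_torsion` — the tower version over `Mod(𝒪_X)` with
  `ε =` multiplication by powers of a global function, levelwise hypotheses and conclusions.

Everything is proved; no named facts; no definitions.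

## References

* The Stacks Project, Tag 088B (Cohomology of Schemes, Lemma 30.27.2), Tag 088C. [StacksProject]
* U. Görtz, T. Wedhorn, *Algebraic Geometry II: Cohomology of Schemes*, Springer Spektrum (2023),
  doi:10.1007/978-3-658-43031-3: Construction 24.104 (3), Lemma 24.105 (pp. 571–573).
  [GortzWedhorn2023]
-/

noncomputable section

open CategoryTheory CategoryTheory.Limits

universe v u w

namespace Literature.AlgebraicGeometry.Morphisms

/-! ### The roof with an isogeny as first leg -/

section Abelian

variable {C : Type u} [Category.{v} C] [Abelian C]
  (ε : ∀ Z : C, Z ⟶ Z) (hε : ∀ {Z Z' : C} (f : Z ⟶ Z'), ε Z ≫ f = f ≫ ε Z')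

include hε in
/-- **The roof with an isogeny as first leg.** Let `u : F → B` have kernel killed by a central `ε''`
and cokernel killed by a central `ε'`, and `v : A → B` kernel and cokernel killed by a central `ε`.
Then there is `α : F → A` (namely `u` followed by a quasi-inverse of `v`) whose kernel is killed by
`ε²ε''` and whose cokernel is killed by `ε'ε²` (generalized-element form).
[cite: StacksProject, Tag 088B] -/
theorem exists_hom_of_roof_of_torsion (ε' : ∀ Z : C, Z ⟶ Z)
    (hε' : ∀ {Z Z' : C} (f : Z ⟶ Z'), ε' Z ≫ f = f ≫ ε' Z') (ε'' : ∀ Z : C, Z ⟶ Z)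
    {F A B : C} (u : F ⟶ B) (v : A ⟶ B)
    (huk : ∀ {T : C} (z : T ⟶ F), z ≫ u = 0 → z ≫ ε'' F = 0)
    (hu : ∀ {T : C} (q : B ⟶ T), u ≫ q = 0 → ε' B ≫ q = 0)
    (hk : ∀ {T : C} (z : T ⟶ A), z ≫ v = 0 → z ≫ ε A = 0)
    (hc : ∀ {T : C} (q : B ⟶ T), v ≫ q = 0 → ε B ≫ q = 0) :
    ∃ α : F ⟶ A, (∀ {T : C} (z : T ⟶ F), z ≫ α = 0 → z ≫ ε F ≫ ε F ≫ ε'' F = 0) ∧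
      ∀ {T : C} (q : A ⟶ T), α ≫ q = 0 → ε' A ≫ ε A ≫ ε A ≫ q = 0 := by
  obtain ⟨w, hvw, hwv⟩ := exists_quasiInverse_of_torsion_kernel_cokernel ε hε v hk hc
  refine ⟨u ≫ w, fun z hz => ?_, fun q hq => ?_⟩
  · -- `(z ≫ ε²) ≫ u = z ≫ u ≫ ε² = z ≫ u ≫ w ≫ v = 0`, so `ε''` kills `z ≫ ε²`
    have hz' : z ≫ u ≫ w = 0 := by simpa only [Category.assoc] using hz
    have h2 : (z ≫ ε F ≫ ε F) ≫ u = 0 := by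
      simp only [Category.assoc]
      rw [hε u, reassoc_of% (hε u), ← hwv, reassoc_of% hz', zero_comp]
    simpa only [Category.assoc] using huk _ h2
  · -- `ε' ≫ ε² ≫ q = ε' ≫ v ≫ w ≫ q = v ≫ ε'_B ≫ w ≫ q`, and `u ≫ (w ≫ q) = 0`
    have hq' : u ≫ w ≫ q = 0 := by simpa only [Category.assoc] using hq
    rw [← reassoc_of% hvw, reassoc_of% (hε' v), hu _ hq', comp_zero]

end Abelian

/-! ### Towers of `𝒪_X`-modules -/

section Towers

open _root_.AlgebraicGeometry Literature.AlgebraicGeometry.Modules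

variable {X : Scheme.{w}} (b : Γ(X, ⊤))

/-- Multiplication by `b` on every level of a tower is a morphism of towers. [folklore] -/
private theorem globalScalar_naturality' (T : ℕᵒᵖ ⥤ X.Modules) {k k' : ℕᵒᵖ} (g : k ⟶ k') :
    T.map g ≫ globalScalar (T.obj k') b = globalScalar (T.obj k) b ≫ T.map g :=
  (globalScalar_comp (T.map g) b).symm

/-- **The roof for towers of `𝒪_X`-modules, with an isogeny as first leg.** Let `u : 𝓕 → P` and
`v : 𝓗 → P` be morphisms of towers `ℕᵒᵖ ⥤ Mod(𝒪_X)` and `b` a global function such that,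
levelwise, `u_n` has kernel killed by `b^c''` and cokernel killed by `b^c'`, and `v_n` has kernel and
cokernel killed by `bᶜ`. Then there is a morphism of towers `α : 𝓕 → 𝓗` whose levelwise kernels are
killed by `b^(2c+c'')` and cokernels by `b^(2c+c')`. [cite: StacksProject, Tag 088B]
[cite: GortzWedhorn2023, Construction 24.104 (3) and Lemma 24.105 (pp. 571–573)] -/
theorem exists_towerHom_of_powTorsion_roof_of_torsion {𝓕 P 𝓗 : ℕᵒᵖ ⥤ X.Modules} (u : 𝓕 ⟶ P)
    (v : 𝓗 ⟶ P) {c c' c'' : ℕ}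
    (huk : ∀ n, kernel.ι (u.app n) ≫ globalScalar (𝓕.obj n) (b ^ c'') = 0)
    (huc : ∀ n, globalScalar (P.obj n) (b ^ c') ≫ cokernel.π (u.app n) = 0)
    (hvk : ∀ n, kernel.ι (v.app n) ≫ globalScalar (𝓗.obj n) (b ^ c) = 0)
    (hvc : ∀ n, globalScalar (P.obj n) (b ^ c) ≫ cokernel.π (v.app n) = 0) :
    ∃ α : 𝓕 ⟶ 𝓗, ∀ n, kernel.ι (α.app n) ≫ globalScalar (𝓕.obj n) (b ^ (c + c + c'')) = 0 ∧
      globalScalar (𝓗.obj n) (b ^ (c + c + c')) ≫ cokernel.π (α.app n) = 0 := by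
  -- the central endomorphisms "multiplication by `bᶜ`", "by `b^c'`", "by `b^c''`"
  let ε : ∀ T : ℕᵒᵖ ⥤ X.Modules, T ⟶ T := fun T =>
    { app := fun k => globalScalar (T.obj k) (b ^ c)
      naturality := fun _ _ g => globalScalar_naturality' _ T g }
  let ε' : ∀ T : ℕᵒᵖ ⥤ X.Modules, T ⟶ T := fun T =>
    { app := fun k => globalScalar (T.obj k) (b ^ c')
      naturality := fun _ _ g => globalScalar_naturality' _ T g }
  let ε'' : ∀ T : ℕᵒᵖ ⥤ X.Modules, T ⟶ T := fun T =>
    { app := fun k => globalScalar (T.obj k) (b ^ c'')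
      naturality := fun _ _ g => globalScalar_naturality' _ T g }
  have hε : ∀ {T T' : ℕᵒᵖ ⥤ X.Modules} (f : T ⟶ T'), ε T ≫ f = f ≫ ε T' := fun f =>
    NatTrans.ext (funext fun k => globalScalar_comp (f.app k) _)
  have hε' : ∀ {T T' : ℕᵒᵖ ⥤ X.Modules} (f : T ⟶ T'), ε' T ≫ f = f ≫ ε' T' := fun f =>
    NatTrans.ext (funext fun k => globalScalar_comp (f.app k) _)
  -- levelwise hypotheses ⇒ generalized-element hypotheses in the functor category
  have huk' : ∀ {T : ℕᵒᵖ ⥤ X.Modules} (z : T ⟶ 𝓕), z ≫ u = 0 → z ≫ ε'' 𝓕 = 0 := by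
    intro T z hz
    refine NatTrans.ext (funext fun k => ?_)
    have hzk : z.app k ≫ u.app k = 0 := by rw [← NatTrans.comp_app, hz, NatTrans.app_zero]
    rw [NatTrans.comp_app, NatTrans.app_zero]
    change z.app k ≫ globalScalar (𝓕.obj k) (b ^ c'') = 0
    rw [← kernel.lift_ι (u.app k) (z.app k) hzk, Category.assoc, huk k, comp_zero]
  have hu' : ∀ {T : ℕᵒᵖ ⥤ X.Modules} (q : P ⟶ T), u ≫ q = 0 → ε' P ≫ q = 0 := by
    intro T q hq
    refine NatTrans.ext (funext fun k => ?_)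
    have hqk : u.app k ≫ q.app k = 0 := by rw [← NatTrans.comp_app, hq, NatTrans.app_zero]
    rw [NatTrans.comp_app, NatTrans.app_zero]
    change globalScalar (P.obj k) (b ^ c') ≫ q.app k = 0
    rw [← cokernel.π_desc (u.app k) (q.app k) hqk, reassoc_of% (huc k), zero_comp]
  have hk' : ∀ {T : ℕᵒᵖ ⥤ X.Modules} (z : T ⟶ 𝓗), z ≫ v = 0 → z ≫ ε 𝓗 = 0 := by
    intro T z hz
    refine NatTrans.ext (funext fun k => ?_)
    have hzk : z.app k ≫ v.app k = 0 := by rw [← NatTrans.comp_app, hz, NatTrans.app_zero]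
    rw [NatTrans.comp_app, NatTrans.app_zero]
    change z.app k ≫ globalScalar (𝓗.obj k) (b ^ c) = 0
    rw [← kernel.lift_ι (v.app k) (z.app k) hzk, Category.assoc, hvk k, comp_zero]
  have hc' : ∀ {T : ℕᵒᵖ ⥤ X.Modules} (q : P ⟶ T), v ≫ q = 0 → ε P ≫ q = 0 := by
    intro T q hq
    refine NatTrans.ext (funext fun k => ?_)
    have hqk : v.app k ≫ q.app k = 0 := by rw [← NatTrans.comp_app, hq, NatTrans.app_zero]
    rw [NatTrans.comp_app, NatTrans.app_zero]
    change globalScalar (P.obj k) (b ^ c) ≫ q.app k = 0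
    rw [← cokernel.π_desc (v.app k) (q.app k) hqk, reassoc_of% (hvc k), zero_comp]
  obtain ⟨α, hαk, hαc⟩ := exists_hom_of_roof_of_torsion ε hε ε' hε' ε'' u v huk' hu' hk' hc'
  refine ⟨α, fun k => ⟨?_, ?_⟩⟩
  · -- the kernel of `α_k` maps to the level `k` of the kernel of `α`
    let G := (evaluation ℕᵒᵖ X.Modules).obj k
    have hlim : IsLimit ((KernelFork.ofι (kernel.ι α) (kernel.condition α)).map G) :=
      KernelFork.mapIsLimit _ (kernelIsKernel α) G
    let l : kernel (α.app k) ⟶ (kernel α).obj k :=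
      hlim.lift (KernelFork.ofι (kernel.ι (α.app k)) (kernel.condition (α.app k)))
    have hl : l ≫ (kernel.ι α).app k = kernel.ι (α.app k) :=
      hlim.fac (KernelFork.ofι (kernel.ι (α.app k)) (kernel.condition (α.app k)))
        WalkingParallelPair.zero
    have h := congr_app (hαk (kernel.ι α) (kernel.condition α)) k
    rw [NatTrans.comp_app, NatTrans.comp_app, NatTrans.comp_app, NatTrans.app_zero] at h
    change (kernel.ι α).app k ≫ globalScalar (𝓕.obj k) (b ^ c) ≫ globalScalar (𝓕.obj k) (b ^ c) ≫
      globalScalar (𝓕.obj k) (b ^ c'') = 0 at h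
    rw [← hl, show b ^ (c + c + c'') = b ^ c'' * (b ^ c * b ^ c) by ring, globalScalar_mul,
      globalScalar_mul]
    simp only [Category.assoc]
    rw [h, comp_zero]
  · -- the level `k` of the cokernel of `α` maps to the cokernel of `α_k`
    let G := (evaluation ℕᵒᵖ X.Modules).obj k
    have hcolim : IsColimit ((CokernelCofork.ofπ (cokernel.π α) (cokernel.condition α)).map G) :=
      CokernelCofork.mapIsColimit _ (cokernelIsCokernel α) G
    let l : (cokernel α).obj k ⟶ cokernel (α.app k) :=
      hcolim.desc (CokernelCofork.ofπ (cokernel.π (α.app k)) (cokernel.condition (α.app k)))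
    have hl : (cokernel.π α).app k ≫ l = cokernel.π (α.app k) :=
      hcolim.fac (CokernelCofork.ofπ (cokernel.π (α.app k)) (cokernel.condition (α.app k)))
        WalkingParallelPair.one
    have h := congr_app (hαc (cokernel.π α) (cokernel.condition α)) k
    rw [NatTrans.comp_app, NatTrans.comp_app, NatTrans.comp_app, NatTrans.app_zero] at h
    change globalScalar (𝓗.obj k) (b ^ c') ≫ globalScalar (𝓗.obj k) (b ^ c) ≫
      globalScalar (𝓗.obj k) (b ^ c) ≫ (cokernel.π α).app k = 0 at h
    rw [← hl, pow_add, globalScalar_mul, pow_add, globalScalar_mul, Category.assoc, Category.assoc,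
      reassoc_of% h, zero_comp]

end Towers

end Literature.AlgebraicGeometry.Morphisms

end
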